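import Summits.CriticalPhenomena.PercolationContinuityZ3.Theorems.PercNearOneGluingNoHeavyLowerTailAntitheticCyclePlusBoundary
import HarnessLib

/-!
# `NoHeavyLowerTail` (stmt-CriticalPhenomena-4575) — antithetic cluster pairs: THEOREM C′, the BOUNDARY COUNT, part 3 — the boundary colourings as
# TRACES on the cycle: run data, clusters, and the explicit arc / co-arc / full / empty colourings (prim-hp-2 gen 44; HOME/THEOREM-Cprime-delta2-cycle.md
# §2–§3, §12 (L4))

Support file (`--supports stmt-CriticalPhenomena-4575`, hull-port prover `prim-hp-2`, gen 44).  No definitions, no named facts, no sorries; standard axioms.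

SETTING: cycle `v 0 = s, …, v (n−1)` with pair set `E₀ = Cyc.edgeSet n v`, markers `e, f ∉ E₀`.  After the slab reduction of part 4 the boundary sum of
THEOREM C′ runs over colourings `ω ⊆ E₀ ∪ {e, f}` with `e ∈ ω ∌ f`; such a colouring is determined by its trace on `E₀` (`eq_of_traces`).  This file provides:
* `Cyc.Bulk.pre_congr`, `suf_congr`, `iLen_congr`, `jLen_congr` — run lengths only depend on the trace on `E₀`;
* `Cyc.Bulk.edge_mem_runSet_iff` — membership of a cycle pair in a run set;
* `Cyc.Bulk.oneChange_rb`, `oneChange_br` — a non-bulk colouring whose two `s`-pairs have different colours is one-change at `i = iLen ∈ [1, n−1]`, with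
  clusters `(runSet i 0, runSet 0 (n−i))` resp. `(runSet 0 (n−i), runSet i 0)`; `edge_mem_iff_of_runs` — its trace is determined by `i` and the colour;
* `Cyc.Bulk.blue_empty_of_rr`, `red_empty_of_bb` — a non-bulk colouring whose `s`-pairs have the same colour has an empty cluster of the other colour;
* the explicit colourings `insert e (runSet k (n−1−k))` (ARC), `insert e {edge k}` (CO-ARC), `insert e E₀` (FULL), `{e}` (EMPTY): run data, `iLen`, clusters.
[cite: VandenbergHaggstromKahn2005, §1 p. 3 (open cluster `C_s`)]
-/

noncomputable section

namespace Summit.CriticalPhenomena.PercolationContinuityZ3.Theorems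

open Literature.Probability.Percolation
open scoped Classical symmDiff

namespace Antithetic

namespace Cyc

namespace Bulk

variable {V : Type*} {n : ℕ} {v : ℕ → V}

section Congr

variable (ω ω' : Set (Sym2 V))

/-- `pre` only depends on the trace on the cycle. [this work] -/
theorem pre_congr (h : ∀ k, k < n → (edge v k ∈ ω' ↔ edge v k ∈ ω)) : pre n v ω' = pre n v ω :=
  pre_eq_of ω' (pre_le ω) (fun k hk => (h k (lt_of_lt_of_le hk (pre_le ω))).2 (red_of_lt_pre ω hk))
    fun hlt hmem => not_red_pre ω hlt ((h _ hlt).1 hmem)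

/-- `suf` only depends on the trace on the cycle. [this work] -/
theorem suf_congr (h : ∀ k, k < n → (edge v k ∈ ω' ↔ edge v k ∈ ω)) : suf n v ω' = suf n v ω := by
  have hs := suf_le (n := n) (v := v) ω
  exact suf_eq_of ω' hs (fun k hk => (h (n - 1 - k) (by omega)).2 (red_of_lt_suf ω hk))
    fun hlt hmem => not_red_suf ω hlt ((h _ (by omega)).1 hmem)

/-- `iLen` only depends on the trace on the cycle. [this work] -/
theorem iLen_congr (hn : 1 ≤ n) (h : ∀ k, k < n → (edge v k ∈ ω' ↔ edge v k ∈ ω)) : iLen n v ω' = iLen n v ω := by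
  have hc : ∀ k, k < n → (edge v k ∈ ω'ᶜ ↔ edge v k ∈ ωᶜ) := fun k hk => by rw [Set.mem_compl_iff, Set.mem_compl_iff, h k hk]
  unfold iLen
  rw [h 0 (by omega), pre_congr ω ω' h, pre_congr ωᶜ ω'ᶜ hc]

/-- `jLen` only depends on the trace on the cycle. [this work] -/
theorem jLen_congr (hn : 1 ≤ n) (h : ∀ k, k < n → (edge v k ∈ ω' ↔ edge v k ∈ ω)) : jLen n v ω' = jLen n v ω := by
  have hc : ∀ k, k < n → (edge v k ∈ ω'ᶜ ↔ edge v k ∈ ωᶜ) := fun k hk => by rw [Set.mem_compl_iff, Set.mem_compl_iff, h k hk]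
  unfold jLen
  rw [h (n - 1) (by omega), suf_congr ω ω' h, suf_congr ωᶜ ω'ᶜ hc]

/-- Clockwise run datum from `iLen` when `edge 0` is red. [this work] -/
theorem cwRun_of_mem (h0 : edge v 0 ∈ ω) : ω ∈ cwRun n v True (iLen n v ω) := (cwRun_congr (iff_true_intro h0) ω).1 (cwRun_iLen ω)

/-- Clockwise run datum from `iLen` when `edge 0` is blue. [this work] -/
theorem cwRun_of_not_mem (h0 : edge v 0 ∉ ω) : ω ∈ cwRun n v False (iLen n v ω) := (cwRun_congr (iff_false_intro h0) ω).1 (cwRun_iLen ω)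

/-- Counter-clockwise run datum from `jLen` when `edge (n−1)` is red. [this work] -/
theorem ccwRun_of_mem (h1 : edge v (n - 1) ∈ ω) : ω ∈ ccwRun n v True (jLen n v ω) :=
  (ccwRun_congr (iff_true_intro h1) ω).1 (ccwRun_jLen ω)

/-- Counter-clockwise run datum from `jLen` when `edge (n−1)` is blue. [this work] -/
theorem ccwRun_of_not_mem (h1 : edge v (n - 1) ∉ ω) : ω ∈ ccwRun n v False (jLen n v ω) :=
  (ccwRun_congr (iff_false_intro h1) ω).1 (ccwRun_jLen ω)

end Congr

section Geometry

variable (hn : 3 ≤ n) (hinj : ∀ i j, i < n → j < n → v i = v j → i = j) (hper : v n = v 0)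
include hn hinj hper

/-- Membership of a cycle pair in a run set. [this work] -/
theorem edge_mem_runSet_iff {a b k : ℕ} (hk : k < n) : edge v k ∈ runSet n v a b ↔ (k < a ∨ n ≤ k + b) := by
  constructor
  · rintro ⟨k', hk', hkk', h⟩
    rw [edge_inj hn hinj hper hk hk' hkk']
    exact h
  · exact fun h => ⟨k, hk, rfl, h⟩

omit hn hinj hper in
/-- A cycle pair is not a marker off the cycle. [this work] -/
theorem edge_ne_of_notMem {e : Sym2 V} (he : e ∉ edgeSet n v) {k : ℕ} (hk : k < n) : edge v k ≠ e :=
  fun h => he (h ▸ ⟨k, hk, rfl⟩)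

omit hn hinj hper in
/-- **The trace of a one-change colouring is determined by its position and colour**: with clockwise run `(c, i)` and counter-clockwise run
`(¬c, n − i)`, a cycle pair `edge k` (`k < n`) has colour `c` iff `k < i`. [this work] -/
theorem edge_mem_iff_of_runs {ω : Set (Sym2 V)} {c : Prop} {i k : ℕ} (hcw : ω ∈ cwRun n v c i) (hccw : ω ∈ ccwRun n v (¬ c) (n - i))
    (hk : k < n) : (edge v k ∈ ω ↔ c) ↔ k < i := by
  by_cases hki : k < i
  · exact iff_of_true (hcw.1 k hki) hki
  · refine iff_of_false (fun h => ?_) hki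
    have h2 := hccw.1 (n - 1 - k) (by omega)
    rw [show n - 1 - (n - 1 - k) = k by omega] at h2
    by_cases hc : c
    · exact h2.1 (h.2 hc) hc
    · exact hc (h.1 (h2.2 hc))

/-- **Clusters of a `br` one-change colouring** (blue clockwise run `i`, red counter-clockwise run `n − i`): red `runSet 0 (n−i)`, blue `runSet i 0`.
[this work] -/
theorem clusters_oneChange' {ω : Set (Sym2 V)} {i : ℕ} (hcw : ω ∈ cwRun n v False i) (hccw : ω ∈ ccwRun n v True (n - i)) (hi1 : 1 ≤ i)
    (hin : i + 1 ≤ n) :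
    openEdgeCluster (ω ∩ edgeSet n v) (v 0) = runSet n v 0 (n - i) ∧ openEdgeCluster (ωᶜ ∩ edgeSet n v) (v 0) = runSet n v i 0 := by
  have h1 : pre n v ω = 0 := (cwRun_pre_other ω hcw (by omega)).2 id
  have h2 : suf n v ω = n - i := ccwRun_suf ω hccw trivial (by omega)
  have h3 : pre n v ωᶜ = i := cwRun_pre_compl ω hcw id (by omega)
  have h4 : suf n v ωᶜ = 0 := (ccwRun_suf_other ω hccw (by omega)).1 trivial
  exact ⟨by rw [cluster_eq_runSet hn hinj hper, h1, h2], by rw [cluster_eq_runSet hn hinj hper, h3, h4]⟩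

/-- **Clusters of a co-arc** (both `s`-pairs blue, blue runs `k` and `n−1−k`): red `∅`, blue `runSet k (n−1−k)`. [this work] -/
theorem clusters_coarc {ω : Set (Sym2 V)} {k : ℕ} (hcw : ω ∈ cwRun n v False k) (hccw : ω ∈ ccwRun n v False (n - 1 - k)) (hk1 : 1 ≤ k)
    (hk2 : k + 2 ≤ n) :
    openEdgeCluster (ω ∩ edgeSet n v) (v 0) = ∅ ∧ openEdgeCluster (ωᶜ ∩ edgeSet n v) (v 0) = runSet n v k (n - 1 - k) := by
  have h1 : pre n v ω = 0 := (cwRun_pre_other ω hcw (by omega)).2 id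
  have h2 : suf n v ω = 0 := (ccwRun_suf_other ω hccw (by omega)).2 id
  have h3 : pre n v ωᶜ = k := cwRun_pre_compl ω hcw id (by omega)
  have h4 : suf n v ωᶜ = n - 1 - k := ccwRun_suf_compl ω hccw id (by omega)
  exact ⟨by rw [cluster_eq_runSet hn hinj hper, h1, h2, runSet_zero], by rw [cluster_eq_runSet hn hinj hper, h3, h4]⟩

/-- **Clusters of the all-blue colouring**: red `∅`, blue `runSet n n`. [this work] -/
theorem clusters_cofull {ω : Set (Sym2 V)} (hcw : ω ∈ cwRun n v False n) (hccw : ω ∈ ccwRun n v False n) :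
    openEdgeCluster (ω ∩ edgeSet n v) (v 0) = ∅ ∧ openEdgeCluster (ωᶜ ∩ edgeSet n v) (v 0) = runSet n v n n := by
  have h1 : pre n v ω = 0 := (cwRun_pre_other ω hcw (by omega)).2 id
  have h2 : suf n v ω = 0 := (ccwRun_suf_other ω hccw (by omega)).2 id
  have h3 : pre n v ωᶜ = n := cwRun_pre_compl ω hcw id le_rfl
  have h4 : suf n v ωᶜ = n := ccwRun_suf_compl ω hccw id le_rfl
  exact ⟨by rw [cluster_eq_runSet hn hinj hper, h1, h2, runSet_zero], by rw [cluster_eq_runSet hn hinj hper, h3, h4]⟩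

/-- **A non-bulk colouring with `edge 0` red and `edge (n−1)` blue is `rb` one-change at `i = iLen ∈ [1, n−1]`**, with clusters
`(runSet i 0, runSet 0 (n−i))`. [this work] -/
theorem oneChange_rb {ω : Set (Sym2 V)} (h0 : edge v 0 ∈ ω) (h1 : edge v (n - 1) ∉ ω) (hnb : n < iLen n v ω + jLen n v ω + 2) :
    1 ≤ iLen n v ω ∧ iLen n v ω + 1 ≤ n ∧ ω ∈ cwRun n v True (iLen n v ω) ∧ ω ∈ ccwRun n v False (n - iLen n v ω) ∧
      openEdgeCluster (ω ∩ edgeSet n v) (v 0) = runSet n v (iLen n v ω) 0 ∧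
      openEdgeCluster (ωᶜ ∩ edgeSet n v) (v 0) = runSet n v 0 (n - iLen n v ω) := by
  have hi1 := one_le_iLen (n := n) (v := v) ω (by omega)
  have hj1 := one_le_jLen (n := n) (v := v) ω (by omega)
  rcases nonbulk_cases hn ω hnb with ⟨hsame, -⟩ | ⟨-, hsum⟩
  · exact absurd (hsame.1 h0) h1
  have hcw := cwRun_of_mem (n := n) ω h0
  have hccw : ω ∈ ccwRun n v False (n - iLen n v ω) := by
    rw [show n - iLen n v ω = jLen n v ω by omega]; exact ccwRun_of_not_mem ω h1
  exact ⟨hi1, by omega, hcw, hccw, clusters_oneChange hn hinj hper hcw hccw hi1 (by omega)⟩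

/-- **A non-bulk colouring with `edge 0` blue and `edge (n−1)` red is `br` one-change at `i = iLen ∈ [1, n−1]`**, with clusters
`(runSet 0 (n−i), runSet i 0)`. [this work] -/
theorem oneChange_br {ω : Set (Sym2 V)} (h0 : edge v 0 ∉ ω) (h1 : edge v (n - 1) ∈ ω) (hnb : n < iLen n v ω + jLen n v ω + 2) :
    1 ≤ iLen n v ω ∧ iLen n v ω + 1 ≤ n ∧ ω ∈ cwRun n v False (iLen n v ω) ∧ ω ∈ ccwRun n v True (n - iLen n v ω) ∧
      openEdgeCluster (ω ∩ edgeSet n v) (v 0) = runSet n v 0 (n - iLen n v ω) ∧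
      openEdgeCluster (ωᶜ ∩ edgeSet n v) (v 0) = runSet n v (iLen n v ω) 0 := by
  have hi1 := one_le_iLen (n := n) (v := v) ω (by omega)
  have hj1 := one_le_jLen (n := n) (v := v) ω (by omega)
  rcases nonbulk_cases hn ω hnb with ⟨hsame, -⟩ | ⟨-, hsum⟩
  · exact absurd (hsame.2 h1) h0
  have hcw := cwRun_of_not_mem (n := n) ω h0
  have hccw : ω ∈ ccwRun n v True (n - iLen n v ω) := by
    rw [show n - iLen n v ω = jLen n v ω by omega]; exact ccwRun_of_mem ω h1
  exact ⟨hi1, by omega, hcw, hccw, clusters_oneChange' hn hinj hper hcw hccw hi1 (by omega)⟩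

/-- **A non-bulk colouring with both `s`-pairs red has an empty blue cluster** (it is a near-full arc or all red). [this work] -/
theorem blue_empty_of_rr {ω : Set (Sym2 V)} (h0 : edge v 0 ∈ ω) (h1 : edge v (n - 1) ∈ ω) (hnb : n < iLen n v ω + jLen n v ω + 2) :
    openEdgeCluster (ωᶜ ∩ edgeSet n v) (v 0) = ∅ := by
  have hi1 := one_le_iLen (n := n) (v := v) ω (by omega)
  have hj1 := one_le_jLen (n := n) (v := v) ω (by omega)
  have hcw := cwRun_of_mem (n := n) ω h0
  have hccw := ccwRun_of_mem (n := n) ω h1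
  rcases nonbulk_cases hn ω hnb with ⟨-, harc | ⟨hi, hj⟩⟩ | ⟨hne, -⟩
  · rw [show jLen n v ω = n - 1 - iLen n v ω by omega] at hccw
    exact (clusters_arc hn hinj hper hcw hccw hi1 (by omega)).2
  · rw [hi] at hcw; rw [hj] at hccw
    exact (clusters_full hn hinj hper hcw hccw).2
  · exact absurd (iff_of_true h0 h1) hne

/-- **A non-bulk colouring with both `s`-pairs blue has an empty red cluster** (co-arc or all blue). [this work] -/
theorem red_empty_of_bb {ω : Set (Sym2 V)} (h0 : edge v 0 ∉ ω) (h1 : edge v (n - 1) ∉ ω) (hnb : n < iLen n v ω + jLen n v ω + 2) :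
    openEdgeCluster (ω ∩ edgeSet n v) (v 0) = ∅ := by
  have hi1 := one_le_iLen (n := n) (v := v) ω (by omega)
  have hj1 := one_le_jLen (n := n) (v := v) ω (by omega)
  have hcw := cwRun_of_not_mem (n := n) ω h0
  have hccw := ccwRun_of_not_mem (n := n) ω h1
  rcases nonbulk_cases hn ω hnb with ⟨-, harc | ⟨hi, hj⟩⟩ | ⟨hne, -⟩
  · rw [show jLen n v ω = n - 1 - iLen n v ω by omega] at hccw
    exact (clusters_coarc hn hinj hper hcw hccw hi1 (by omega)).1
  · rw [hi] at hcw; rw [hj] at hccw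
    exact (clusters_cofull hn hinj hper hcw hccw).1
  · exact absurd (iff_of_false h0 h1) hne

end Geometry

section Explicit

variable (hn : 3 ≤ n) (hinj : ∀ i j, i < n → j < n → v i = v j → i = j) (hper : v n = v 0) {e : Sym2 V} (he : e ∉ edgeSet n v)
include hn hinj hper he

/-- Trace of the ARC colouring `insert e (runSet k (n−1−k))`. [this work] -/
theorem edge_mem_arc_iff {k k' : ℕ} (hk' : k' < n) : edge v k' ∈ insert e (runSet n v k (n - 1 - k)) ↔ (k' < k ∨ n ≤ k' + (n - 1 - k)) := by
  rw [Set.mem_insert_iff, edge_mem_runSet_iff hn hinj hper hk', or_iff_right (edge_ne_of_notMem he hk')]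

/-- The arc colouring has red clockwise run `k`. [this work] -/
theorem arc_cwRun {k : ℕ} (hk2 : k + 2 ≤ n) : insert e (runSet n v k (n - 1 - k)) ∈ cwRun n v True k :=
  ⟨fun k' hk' => iff_true_intro ((edge_mem_arc_iff hn hinj hper he (by omega)).2 (Or.inl hk')), fun hkn h => by
    have := (edge_mem_arc_iff hn hinj hper he hkn).1 (h.2 trivial); omega⟩

/-- The arc colouring has red counter-clockwise run `n − 1 − k`. [this work] -/
theorem arc_ccwRun {k : ℕ} (hk2 : k + 2 ≤ n) : insert e (runSet n v k (n - 1 - k)) ∈ ccwRun n v True (n - 1 - k) :=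
  ⟨fun k' hk' => iff_true_intro ((edge_mem_arc_iff hn hinj hper he (by omega)).2 (Or.inr (by omega))), fun _ h => by
    have := (edge_mem_arc_iff hn hinj hper he (k' := n - 1 - (n - 1 - k)) (by omega)).1 (h.2 trivial); omega⟩

/-- `iLen` of the arc colouring is `k` (`1 ≤ k ≤ n − 2`). [this work] -/
theorem iLen_arc {k : ℕ} (hk1 : 1 ≤ k) (hk2 : k + 2 ≤ n) : iLen n v (insert e (runSet n v k (n - 1 - k))) = k :=
  iLen_eq_of_cwRun _ (arc_cwRun hn hinj hper he hk2) hk1 (by omega)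

/-- `jLen` of the arc colouring is `n − 1 − k`. [this work] -/
theorem jLen_arc {k : ℕ} (hk1 : 1 ≤ k) (hk2 : k + 2 ≤ n) : jLen n v (insert e (runSet n v k (n - 1 - k))) = n - 1 - k :=
  jLen_eq_of_ccwRun _ (arc_ccwRun hn hinj hper he hk2) (by omega) (by omega)

/-- Trace of the CO-ARC colouring `insert e {edge k}`. [this work] -/
theorem edge_mem_coarc_iff {k k' : ℕ} (hk : k < n) (hk' : k' < n) : edge v k' ∈ insert e ({edge v k} : Set (Sym2 V)) ↔ k' = k := by
  rw [Set.mem_insert_iff, Set.mem_singleton_iff, or_iff_right (edge_ne_of_notMem he hk')]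
  exact ⟨fun h => edge_inj hn hinj hper hk' hk h, fun h => h ▸ rfl⟩

/-- The co-arc colouring has blue clockwise run `k`. [this work] -/
theorem coarc_cwRun {k : ℕ} (hk2 : k + 2 ≤ n) : insert e ({edge v k} : Set (Sym2 V)) ∈ cwRun n v False k :=
  ⟨fun k' hk' => iff_false_intro fun h => by have := (edge_mem_coarc_iff hn hinj hper he (by omega) (by omega)).1 h; omega,
    fun hkn h => h.1 ((edge_mem_coarc_iff hn hinj hper he hkn hkn).2 rfl)⟩

/-- The co-arc colouring has blue counter-clockwise run `n − 1 − k`. [this work] -/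
theorem coarc_ccwRun {k : ℕ} (hk2 : k + 2 ≤ n) : insert e ({edge v k} : Set (Sym2 V)) ∈ ccwRun n v False (n - 1 - k) :=
  ⟨fun k' hk' => iff_false_intro fun h => by have := (edge_mem_coarc_iff hn hinj hper he (by omega) (by omega)).1 h; omega,
    fun _ h => h.1 ((edge_mem_coarc_iff hn hinj hper he (by omega) (by omega)).2 (by omega))⟩

/-- `iLen` of the co-arc colouring is `k`. [this work] -/
theorem iLen_coarc {k : ℕ} (hk1 : 1 ≤ k) (hk2 : k + 2 ≤ n) : iLen n v (insert e ({edge v k} : Set (Sym2 V))) = k :=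
  iLen_eq_of_cwRun _ (coarc_cwRun hn hinj hper he hk2) hk1 (by omega)

/-- `jLen` of the co-arc colouring is `n − 1 − k`. [this work] -/
theorem jLen_coarc {k : ℕ} (hk1 : 1 ≤ k) (hk2 : k + 2 ≤ n) : jLen n v (insert e ({edge v k} : Set (Sym2 V))) = n - 1 - k :=
  jLen_eq_of_ccwRun _ (coarc_ccwRun hn hinj hper he hk2) (by omega) (by omega)

omit hn hinj hper he in
/-- The FULL colouring `insert e E₀` has red clockwise run `n`. [this work] -/
theorem full_cwRun : insert e (edgeSet n v) ∈ cwRun n v True n :=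
  ⟨fun k' hk' => iff_true_intro (Set.mem_insert_of_mem _ ⟨k', hk', rfl⟩), fun h => absurd h (lt_irrefl n)⟩

omit hn hinj hper he in
/-- The full colouring has red counter-clockwise run `n`. [this work] -/
theorem full_ccwRun : insert e (edgeSet n v) ∈ ccwRun n v True n :=
  ⟨fun k' hk' => iff_true_intro (Set.mem_insert_of_mem _ ⟨n - 1 - k', by omega, rfl⟩), fun h => absurd h (lt_irrefl n)⟩

omit hinj hper he in
/-- `iLen` of the full colouring is `n`. [this work] -/
theorem iLen_full : iLen n v (insert e (edgeSet n v)) = n := iLen_eq_of_cwRun _ full_cwRun (by omega) le_rfl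

omit hinj hper he in
/-- `jLen` of the full colouring is `n`. [this work] -/
theorem jLen_full : jLen n v (insert e (edgeSet n v)) = n := jLen_eq_of_ccwRun _ full_ccwRun (by omega) le_rfl

omit hn hinj hper in
/-- The EMPTY colouring `{e}` has blue clockwise run `n`. [this work] -/
theorem empty_cwRun : ({e} : Set (Sym2 V)) ∈ cwRun n v False n :=
  ⟨fun _ hk => iff_false_intro fun h => edge_ne_of_notMem he hk (Set.mem_singleton_iff.1 h), fun h => absurd h (lt_irrefl n)⟩

omit hn hinj hper in
/-- The empty colouring has blue counter-clockwise run `n`. [this work] -/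
theorem empty_ccwRun : ({e} : Set (Sym2 V)) ∈ ccwRun n v False n :=
  ⟨fun _ hk => iff_false_intro fun h => edge_ne_of_notMem he (by omega) (Set.mem_singleton_iff.1 h), fun h => absurd h (lt_irrefl n)⟩

omit hinj hper in
/-- `iLen` of the empty colouring is `n`. [this work] -/
theorem iLen_empty : iLen n v ({e} : Set (Sym2 V)) = n := iLen_eq_of_cwRun _ (empty_cwRun he) (by omega) le_rfl

omit hinj hper in
/-- `jLen` of the empty colouring is `n`. [this work] -/
theorem jLen_empty : jLen n v ({e} : Set (Sym2 V)) = n := jLen_eq_of_ccwRun _ (empty_ccwRun he) (by omega) le_rfl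

omit hn hinj hper he in
/-- **Colourings inside `E₀ ∪ {e, f}` containing `e` but not `f` are determined by their traces on `E₀`.** [this work] -/
theorem eq_of_traces {f : Sym2 V} {ω ω' : Set (Sym2 V)} (hω : ω ⊆ insert e (insert f (edgeSet n v))) (hω' : ω' ⊆ insert e (insert f (edgeSet n v)))
    (heω : e ∈ ω) (heω' : e ∈ ω') (hfω : f ∉ ω) (hfω' : f ∉ ω') (h : ∀ k, k < n → (edge v k ∈ ω ↔ edge v k ∈ ω')) : ω = ω' := by
  ext g
  constructor
  · intro hg
    rcases hω hg with rfl | rfl | ⟨k, hk, rfl⟩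
    · exact heω'
    · exact absurd hg hfω
    · exact (h k hk).1 hg
  · intro hg
    rcases hω' hg with rfl | rfl | ⟨k, hk, rfl⟩
    · exact heω
    · exact absurd hg hfω'
    · exact (h k hk).2 hg

end Explicit

end Bulk

end Cyc

end Antithetic

end Summit.CriticalPhenomena.PercolationContinuityZ3.Theorems
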